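import Summits.ResolutionOfSingularities.ResolutionOfSingularities.Theorems.HomologicalConductorNoZenoBaseIdealCartier
import Summits.ResolutionOfSingularities.ResolutionOfSingularities.Theorems.HomologicalConductorNoZenoExcDegreeAvoids
import Summits.ResolutionOfSingularities.ResolutionOfSingularities.Theorems.HomologicalConductorNoZenoCycleDivisor
import HarnessLib

/-!
# Crux `NoZenoR` (stmt-ResolutionOfSingularities-19943), slot 5 `stub_L1wCoreF3`, (B1) split core upstairs —
# UP-3-easy: CURVES INSIDE THE CHART ARE `Z`-TRIVIAL

OURS (cell res-hironaka, chain W4.4; stub worker res-L0-w44-stub-4 g8; object (o-i) named by res-L0-w44-plan-1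
DESK WORD 10, after the lead seat res-L0-w44-lead-1's `B1-CENSUS-g8.md` §1 row UP-3: «curves over `𝔮` are
`Z`-trivial: on `V`, `I·𝒪 = x·𝒪`, so `Z ∼ D₀ := Z − div(x)` with `D₀` AVOIDING every point of `V`; for `η` over `𝔮`
one needs `E_η ⊆ V` ((A2), res-D-pv-045), then degree `0`»).  Nothing here is a statement of the manuscript under review
(Hironaka 2017); AI-written, weaker than expert review; def-free, fact-free.

For the Cartier divisor `Z := CartierDivisor.ofIsEffectiveCartier (𝔞𝒪_X) h` of the base ideal `𝔞 ⊆ T` of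
`π : X → Spec T` (the lead's `…NoZenoBaseIdealCartier`, `𝔞𝒪_X := ofIdealTop (𝔞·Γ(X, 𝒪_X))`) and the `x`-chart
`V ⊆ X` on which `𝔞·𝒪_(X,v) = x·𝒪_(X,v)`:

* GENERIC (any Cartier divisor `D` on an integral `X`, any `h ∈ K(X)ˣ`): `linEquiv_add_principal_inv` (`D ∼ D + div h⁻¹`),
  `avoids_add_principal_inv` (where the local equation of `D` is a unit multiple of `h`, `D + div h⁻¹` avoids the
  point), **`excCurveDegree_eq_zero_of_isUnitAt_div_of_closure_subset`** (if this holds at every point of a set `U`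
  and `closure {η} ⊆ U`, then `(𝒪_X(D) · E_η) = 0` — the lead's `excCurveDegree_eq_zero_of_linEquiv_of_forall_avoids`);
* EFFECTIVE CARTIER IDEAL SHEAVES: `isUnitAt_ofIsEffectiveCartier_f_div` — if the stalk `I_v` is generated by the germ
  of a global section `s`, the local equation of `ofIsEffectiveCartier I` at `v` is a unit multiple of `s`
  (two generators of a principal ideal of the domain `𝒪_(X,v)` are associated);
* THE BASE IDEAL: `map_toStalk_eq_span_of_forall_dvd` (the chart hypothesis from divisibility `x ∣ c` in
  `𝒪_(X,v)` for `c ∈ 𝔞`, the shape U2a's `mul_inv_mem_stalkSubring_of_mem_preimage_chart` delivers),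
  `isUnitAt_baseIdealDivisor_f_div`, and **`excCurveDegree_baseIdealDivisor_eq_zero_of_closure_subset`**: for
  `η ∈ excCurvePoints π` with `closure {η} ⊆ V`, **`excCurveDegree π Z η = 0`** — so the curves contracted into the
  chart germ lie outside the lead's `P = {E : (Z·E) < 0}` (`not_excCurveDegree_baseIdealDivisor_neg_of_closure_subset`,
  the «`C ∩ P = ∅`» input of the (A4) contraction loop).

References: J. Lipman, Publ. Math. IHÉS 36 (1969), §12 Remark 2 b)–c) (p. 221) [`Lipman1969`]; U. Görtz, T. Wedhorn,
*Algebraic Geometry I* (2020), (11.9) and Remark 11.27 [`GortzWedhorn2020`].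
-/

noncomputable section

-- single-problem summit: the doubled namespace component `ResolutionOfSingularities` is forced
set_option linter.dupNamespace false

namespace Summit.ResolutionOfSingularities.ResolutionOfSingularities.Theorems.NoZeno.ExcCount

open CategoryTheory AlgebraicGeometry TopologicalSpace IsLocalRing
open Literature.AlgebraicGeometry Literature.AlgebraicGeometry.Resolution Literature.AlgebraicGeometry.Motives
open Literature.AlgebraicGeometry.Motives.RatFn

universe u

/-! ## Generic: a divisor whose local equations are unit multiples of `h` on `U` is `∼` a divisor avoiding `U` -/

section Generic

variable {X : Scheme.{u}} [IsIntegral X]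

/-- `D ∼ D + div(h⁻¹)` (witness `h⁻¹`). [cite: GortzWedhorn2020, Section (11.9) (p. 374)] -/
theorem linEquiv_add_principal_inv (D : CartierDivisor X) {h : X.functionField} (hh : h ≠ 0) :
    D.LinEquiv (D + CartierDivisor.principal h⁻¹ (inv_ne_zero hh)) :=
  ⟨h⁻¹, inv_ne_zero hh, CartierDivisor.SameDivisor.refl _⟩

/-- Where the local equation of `D` (on some chart through `v`) is a unit multiple of `h`, the divisor
`D + div(h⁻¹)` AVOIDS `v`. [cite: GortzWedhorn2020, Section (11.9) (p. 374)] -/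
theorem avoids_add_principal_inv {D : CartierDivisor X} {h : X.functionField} (hh : h ≠ 0) {v : X} {i : D.ι}
    (hi : v ∈ D.U i) (hu : IsUnitAt v (D.f i / h)) :
    (D + CartierDivisor.principal h⁻¹ (inv_ne_zero hh)).Avoids v :=
  CartierDivisor.Avoids.of_mem (D := D + CartierDivisor.principal h⁻¹ (inv_ne_zero hh)) (i := (i, PUnit.unit))
    ⟨hi, trivial⟩ (by
      change IsUnitAt v (D.f i * h⁻¹)
      rwa [← div_eq_mul_inv])

variable [IsLocallyNoetherian X] {T : Type u} [CommRing T] [IsLocalRing T] (π : X ⟶ Spec (.of T)) [IsProper π]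

/-- **Curves inside `U` are `D`-trivial when `D` is cut out by one rational function on `U`.**  If at every point
`v ∈ U` the local equation of `D` is a unit multiple of the fixed `h ∈ K(X)ˣ`, then every integral exceptional curve
`E_η = closure {η} ⊆ U` has `(𝒪_X(D) · E_η) = 0`: `D ∼ D + div(h⁻¹)`, which avoids every point of `E_η`.
[cite: Lipman1969, Section 12, Remark 2 b)–c) (p. 221)] -/
theorem excCurveDegree_eq_zero_of_isUnitAt_div_of_closure_subset (D : CartierDivisor X) {h : X.functionField}
    (hh : h ≠ 0) {U : Set X} (hU : ∀ v ∈ U, ∃ i, v ∈ D.U i ∧ IsUnitAt v (D.f i / h))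
    {η : X} (hη : η ∈ excCurvePoints π) (hcl : closure ({η} : Set X) ⊆ U) :
    excCurveDegree π D η = 0 :=
  excCurveDegree_eq_zero_of_linEquiv_of_forall_avoids π hη (linEquiv_add_principal_inv D hh) fun y hy => by
    obtain ⟨i, hi, hu⟩ := hU y (hcl (specializes_iff_mem_closure.mp hy))
    exact avoids_add_principal_inv hh hi hu

end Generic

/-! ## Effective Cartier ideal sheaves: a stalk generated by a global section -/

section EffectiveCartier

variable {X : Scheme.{u}} [IsIntegral X] (I : X.IdealSheafData) (hI : IsEffectiveCartier I)

/-- **If the stalk `I_v` is generated by the germ of a global section `s`, the local equation of the divisor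
`ofIsEffectiveCartier I` at `v` is a unit multiple of (the rational function of) `s`**: both germs generate the
principal ideal `I_v` of the domain `𝒪_(X,v)`, hence are associated.
[cite: GortzWedhorn2020, Remark 11.27 and (11.12) (pp. 378–379)] -/
theorem isUnitAt_ofIsEffectiveCartier_f_div {s : Γ(X, ⊤)} {v : X}
    (hs : stalkIdeal I v = Ideal.span {(X.presheaf.germ ⊤ v trivial).hom s}) :
    IsUnitAt v ((CartierDivisor.ofIsEffectiveCartier I hI).f v / secFn (Opens.mem_top v) s) := by
  -- the two generators of `I_v`
  set a : X.presheaf.stalk v := (X.presheaf.germ ⊤ v trivial).hom s with ha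
  set g : X.presheaf.stalk v :=
    (X.presheaf.germ _ v (CartierDivisor.mem_cartierChart I hI v)).hom (CartierDivisor.cartierGen I hI v) with hg
  have hspan : Ideal.span {a} = Ideal.span {g} := by
    rw [← hs, hg]
    exact SandwichCluster.stalkIdeal_eq_span_germ_cartierGen I hI v
  obtain ⟨u, hu⟩ := Ideal.span_singleton_eq_span_singleton.mp hspan
  -- in `K(X)`: `f_v = [g] = [a] · [u]`
  have hfg : (CartierDivisor.ofIsEffectiveCartier I hI).f v = toFunctionField v g := by
    rw [CartierDivisor.ofIsEffectiveCartier_f, hg,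
      toFunctionField_germ_eq_secFn (CartierDivisor.mem_cartierChart I hI v) (CartierDivisor.mem_cartierChart I hI v)]
  have hsa : secFn (Opens.mem_top v) s = toFunctionField v a := by
    rw [ha, toFunctionField_germ_eq_secFn (Opens.mem_top v) (Opens.mem_top v)]
  have hga : toFunctionField v g = toFunctionField v a * toFunctionField v (u : X.presheaf.stalk v) := by
    rw [← map_mul, hu]
  have ha0 : toFunctionField v a ≠ 0 := by
    intro h0
    apply (CartierDivisor.ofIsEffectiveCartier I hI).f_ne_zero v
    rw [hfg, hga, h0, zero_mul]
  refine ⟨u, ?_⟩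
  rw [hfg, hsa, hga, mul_div_cancel_left₀ _ ha0]

end EffectiveCartier

/-! ## The base ideal `𝔞𝒪_X` of `π : X → Spec T` on its `x`-chart -/

section BaseIdeal

variable {T : Type} [CommRing T] {X : Scheme.{0}} (π : X ⟶ Spec (.of T))

/-- **The chart hypothesis from divisibility**: if `x ∈ 𝔞` and `x ∣ c` in `𝒪_(X,v)` for every `c ∈ 𝔞` (on the
`x`-chart of the blow-up every `c·x⁻¹`, `c ∈ 𝔞`, is regular — U2a
`SurfaceTermination.ChartResolution.mul_inv_mem_stalkSubring_of_mem_preimage_chart`), then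
`𝔞·𝒪_(X,v) = x·𝒪_(X,v)`. [folklore] -/
theorem map_toStalk_eq_span_of_forall_dvd {𝔞 : Ideal T} {x : T} (hx : x ∈ 𝔞) {v : X}
    (hdvd : ∀ c ∈ 𝔞, toStalk π v x ∣ toStalk π v c) :
    𝔞.map (toStalk π v) = Ideal.span {toStalk π v x} := by
  apply le_antisymm
  · rw [Ideal.map_le_iff_le_comap]
    intro c hc
    rw [Ideal.mem_comap, Ideal.mem_span_singleton]
    exact hdvd c hc
  · rw [Ideal.span_singleton_le_iff_mem]
    exact Ideal.mem_map_of_mem _ hx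

variable [IsIntegral X] {𝔞 : Ideal T}
  (h : IsEffectiveCartier (Scheme.IdealSheafData.ofIdealTop (𝔞.map (Morphisms.algebraMapΓ π))))

/-- **On the `x`-chart the local equation of `Z` is a unit multiple of `x`**: if `𝔞·𝒪_(X,v) = x·𝒪_(X,v)` then
`f_v / x ∈ 𝒪_(X,v)ˣ` for the local equation `f_v` of `Z = ofIsEffectiveCartier (𝔞𝒪_X)` at `v` and the rational
function of (the global section of) `x`. [cite: GortzWedhorn2020, Remark 11.27 and (11.12) (pp. 378–379)] -/
theorem isUnitAt_baseIdealDivisor_f_div {x : T} {v : X} (hv : 𝔞.map (toStalk π v) = Ideal.span {toStalk π v x}) :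
    IsUnitAt v ((CartierDivisor.ofIsEffectiveCartier _ h).f v /
      secFn (Opens.mem_top v) (Morphisms.algebraMapΓ π x)) := by
  apply isUnitAt_ofIsEffectiveCartier_f_div
  rw [stalkIdeal_baseIdeal_eq_map_toStalk, hv]
  rfl

variable [IsLocallyNoetherian X] [IsLocalRing T] [IsProper π]

/-- **UP-3-easy — CURVES INSIDE THE CHART ARE `Z`-TRIVIAL.**  Let `Z` be the Cartier divisor of the base ideal
`𝔞𝒪_X` and `V ⊆ X` a set on which `𝔞·𝒪_(X,v) = x·𝒪_(X,v)` (the `x`-chart).  Then every integral exceptional curve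
`E_η` with `closure {η} ⊆ V` has `(𝒪_X(Z) · E_η) = 0`: `Z ∼ Z − div(x)`, which avoids every point of `V`.
The nonvanishing of `x` as a rational function is read off the chart hypothesis at `η` itself.
[cite: Lipman1969, Section 12, Remark 2 b)–c) (p. 221)] -/
theorem excCurveDegree_baseIdealDivisor_eq_zero_of_closure_subset {x : T} {V : Set X}
    (hV : ∀ v ∈ V, 𝔞.map (toStalk π v) = Ideal.span {toStalk π v x})
    {η : X} (hη : η ∈ excCurvePoints π) (hcl : closure ({η} : Set X) ⊆ V) :
    excCurveDegree π (CartierDivisor.ofIsEffectiveCartier _ h) η = 0 := by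
  have hηV : η ∈ V := hcl (subset_closure (Set.mem_singleton η))
  -- the rational function of `x` is nonzero: `f_η / x` is a unit at `η`
  have hx0 : secFn (Opens.mem_top η) (Morphisms.algebraMapΓ π x) ≠ 0 := by
    intro h0
    have hu := isUnitAt_baseIdealDivisor_f_div π h (hV η hηV)
    rw [h0, div_zero] at hu
    exact hu.ne_zero rfl
  exact excCurveDegree_eq_zero_of_isUnitAt_div_of_closure_subset π _ hx0
    (fun v hv => ⟨v, CartierDivisor.mem_cartierChart _ h v, isUnitAt_baseIdealDivisor_f_div π h (hV v hv)⟩)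
    hη hcl

/-- Hence such a curve is NOT in the lead's set `P = {E : (Z·E) < 0}` («`C ∩ P = ∅`», the input of the (A4)
contraction loop of `B1-CENSUS-g8`). [this work] -/
theorem not_excCurveDegree_baseIdealDivisor_neg_of_closure_subset {x : T} {V : Set X}
    (hV : ∀ v ∈ V, 𝔞.map (toStalk π v) = Ideal.span {toStalk π v x})
    {η : X} (hη : η ∈ excCurvePoints π) (hcl : closure ({η} : Set X) ⊆ V) :
    ¬ excCurveDegree π (CartierDivisor.ofIsEffectiveCartier _ h) η < 0 := by
  rw [excCurveDegree_baseIdealDivisor_eq_zero_of_closure_subset π h hV hη hcl]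
  exact lt_irrefl 0

/-- The divisibility form of UP-3-easy (chart hypothesis as `x ∣ c` in `𝒪_(X,v)` for `c ∈ 𝔞`, `v ∈ V`).
[cite: Lipman1969, Section 12, Remark 2 b)–c) (p. 221)] -/
theorem excCurveDegree_baseIdealDivisor_eq_zero_of_forall_dvd {x : T} (hx : x ∈ 𝔞) {V : Set X}
    (hV : ∀ v ∈ V, ∀ c ∈ 𝔞, toStalk π v x ∣ toStalk π v c)
    {η : X} (hη : η ∈ excCurvePoints π) (hcl : closure ({η} : Set X) ⊆ V) :
    excCurveDegree π (CartierDivisor.ofIsEffectiveCartier _ h) η = 0 :=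
  excCurveDegree_baseIdealDivisor_eq_zero_of_closure_subset π h
    (fun v hv => map_toStalk_eq_span_of_forall_dvd π hx (hV v hv)) hη hcl

end BaseIdeal

end Summit.ResolutionOfSingularities.ResolutionOfSingularities.Theorems.NoZeno.ExcCount

end
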